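import Summits.HodgeConjecture.CorCM.MumfordTateRankSimpleThreefolds
import Summits.HodgeConjecture.CorCM.MumfordTateRankEllipticProducts
import Summits.HodgeConjecture.CorCM.MumfordTateRankThreeClassification
import Summits.HodgeConjecture.CorCM.MumfordTateRankOfCMAbelianVariety
import Summits.HodgeConjecture.CorCM.MumfordTateRankSubadditive
import Summits.HodgeConjecture.CorCM.CMAbelianFourfoldPowers
import Summits.HodgeConjecture.CorCM.CMProductSimpleFactors
import Literature.AlgebraicGeometry.HodgeTheory.RankOneCentreTimesCMCurveProductSpan
import Literature.AlgebraicGeometry.HodgeTheory.NoTypeIVTimesCMStablyNondegenerate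
import Literature.AlgebraicGeometry.Pohlmann1968.SimpleCMAbelianVarietyPowersDivisorGenerated
import Literature.AlgebraicGeometry.Milne1999.CMTypeSimpleIsogenyFactors
import HarnessLib

/-!
# The Mumford–Tate rank of a CM elliptic curve × a SIMPLE threefold: `23` (`End⁰T = ℚ`), `11` (real cubic `End⁰T`), `∈ {4, 5}` (`T` of CM type)

COR-CM (cell `pub-hodgecm2`, seat `b27` gen 47, count-neutral Mumford–Tate-rank ladder; theorems only, no definition, no named fact;
UNCONDITIONAL — nothing here uses or asserts HC_CM).  Fourfold cells `E × T` with `E` an elliptic curve WITH complex multiplication and `T` a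
simple abelian threefold (`t(T) ∈ {4, 10, 22}` by `dim_ℚ End⁰T ∈ {6, 2 or 3, 1}`, `CorCM/MumfordTateRankSimpleThreefolds`); the companion
`CorCM/MumfordTateRankTimesNonCMCurve` treats a NON-CM curve (`t ∈ {7, 13, 25}`).

* `mtRank_hodge_one_eq_twentythree_of_isIsogenous_cmCurve_prod_threefold_endRankOne` — `End⁰T = ℚ`: `t = 23` (`T` has no factor of type IV,
  Moonen–Zarhin Thm. (3.2)(2): `t + 1 = t(T) + t(E) = 22 + 2`);
* `mtRank_hodge_one_eq_eleven_of_isIsogenous_cmCurve_prod_isSimple_threefold_of_finrank_eq_three` — `End⁰T` a (totally real) cubic field: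
  `t = 11`;
* `mtRank_hodge_one_mem_of_isIsogenous_cmCurve_prod_isSimple_cmThreefold` — `T` of CM type: `t ∈ {4, 5}` (`t ≤ 2 + 4 − 1`; `t ∉ {2, 3}` by the closed
  forms of the rungs `2`, `3` and the uniqueness of simple factors);
* the remaining type, `End⁰T` imaginary quadratic (Ribet type IV (2,1)), has a factor of type IV on both sides; here only `t ≤ 11`.

## References
* [MoonenZarhin1999LowDim] B. Moonen, Yu. G. Zarhin, Math. Ann. 315 (1999), §2 (2.3), §3 Thm. (3.2)(2), Lemma (3.6), Prop. (3.8).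
  [cite: MoonenZarhin1999LowDim, §2 (2.3) and §3 Thm. (3.2)(2)]
* [MumfordAV1970] D. Mumford, *Abelian Varieties*, §19 Thm. 1 and Cor. 1. [cite: MumfordAV1970, §19 Thm. 1]
-/

noncomputable section

open scoped TensorProduct
open CategoryTheory CategoryTheory.Limits Module

namespace Summit.HodgeConjecture.CorCM

open Literature.AlgebraicGeometry.Motives
open Literature.AlgebraicGeometry.Motives.AbelianVariety
open Literature.AlgebraicGeometry.Motives.HodgeStructure
open Literature.AlgebraicGeometry.HodgeTheory
open Literature.AlgebraicGeometry.Milne1999 (IsOfCMType isOfCMType_iff_of_isIsogenous)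
open Literature.AlgebraicGeometry.Pohlmann1968 (isIsogenous_powSucc_biproduct)
open Summit.HodgeConjecture.CorCM.Domination

variable [HodgeTensorFacts.{0, 0}] {X : AbelianVariety ℂ} {n : ℕ}

/-- **`t(E × T) = t(T) + 1` for a CM elliptic curve `E` and a threefold `T` without factor of type IV** (Moonen–Zarhin Thm. (3.2)(2)).
[cite: MoonenZarhin1999LowDim, §3 Thm. (3.2)(2)] -/
theorem mtRank_hodge_one_eq_add_one_of_isIsogenous_cmCurve_prod_threefold (hX : IsSmoothProjective n X.X) {E T : AbelianVariety ℂ} {k : ℕ}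
    (hT : IsSmoothProjective k T.X) (hE1 : E.dim = 1) (hcm : IsOfCMType E) (hT0 : 0 < T.dim) (hT4 : HasNoTypeIVFactor T)
    (hXP : IsIsogenous X (E.prod T)) :
    haveI := BettiUniverse.finite hX 1
    haveI := BettiUniverse.finite hT 1
    (BettiUniverse.hodge exists_isReal_hodgeModel_holds hX 1).mtRank = (BettiUniverse.hodge exists_isReal_hodgeModel_holds hT 1).mtRank + 1 := by
  have hE : IsSmoothProjective E.dim E.X := AbelianVariety.isSmoothProjective_holds
  haveI := BettiUniverse.finite hX 1
  haveI := BettiUniverse.finite hE 1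
  haveI := BettiUniverse.finite hT 1
  have h2 := mtRank_hodge_one_eq_two_of_cm_curve hE1 hcm
  have h := mtRank_hodge_one_add_one_eq_add_of_isIsogenous_prod hX hT hE hT0 (by omega) hT4 hcm (hXP.trans (isIsogenous_prod_comm E T))
  omega

/-- **CM curve × threefold with `End⁰T = ℚ`: `t = 23`** (`Hg = Sp₆ ×` a rank-one torus). [cite: MoonenZarhin1999LowDim, §2 (2.3) and §3 Thm. (3.2)(2)] -/
theorem mtRank_hodge_one_eq_twentythree_of_isIsogenous_cmCurve_prod_threefold_endRankOne (hX : IsSmoothProjective n X.X)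
    {E T : AbelianVariety ℂ} (hE1 : E.dim = 1) (hcm : IsOfCMType E) (hT3 : T.dim = 3) (hTE : Module.finrank ℚ T.endAlgebra = 1)
    (hXP : IsIsogenous X (E.prod T)) :
    haveI := BettiUniverse.finite hX 1
    (BettiUniverse.hodge exists_isReal_hodgeModel_holds hX 1).mtRank = 23 := by
  have hT : IsSmoothProjective T.dim T.X := AbelianVariety.isSmoothProjective_holds
  haveI := BettiUniverse.finite hX 1
  haveI := BettiUniverse.finite hT 1
  obtain ⟨h22, -⟩ := mtRank_hodge_one_eq_twentytwo_of_threefold_of_finrank_endAlgebra_eq_one hT hT3 hTE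
  have h := mtRank_hodge_one_eq_add_one_of_isIsogenous_cmCurve_prod_threefold hX hT hE1 hcm (by omega)
    (hasNoTypeIVFactor_of_finrank_endAlgebra_eq_one hTE) hXP
  omega

/-- **CM curve × simple threefold with a cubic (totally real) endomorphism field: `t = 11`** (`t(T) = 10`, no factor of type IV).
[cite: MoonenZarhin1999LowDim, §2 (2.3) and §3 Thm. (3.2)(2)] -/
theorem mtRank_hodge_one_eq_eleven_of_isIsogenous_cmCurve_prod_isSimple_threefold_of_finrank_eq_three (hX : IsSmoothProjective n X.X)
    {E T : AbelianVariety ℂ} (hE1 : E.dim = 1) (hcm : IsOfCMType E) (hTs : T.IsSimple) (hT3 : T.dim = 3)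
    (hTE : Module.finrank ℚ T.endAlgebra = 3) (hXP : IsIsogenous X (E.prod T)) :
    haveI := BettiUniverse.finite hX 1
    (BettiUniverse.hodge exists_isReal_hodgeModel_holds hX 1).mtRank = 11 := by
  have hT : IsSmoothProjective T.dim T.X := AbelianVariety.isSmoothProjective_holds
  haveI := BettiUniverse.finite hX 1
  haveI := BettiUniverse.finite hT 1
  have h10 : (BettiUniverse.hodge exists_isReal_hodgeModel_holds hT 1).mtRank = 10 := by
    rcases mtRank_hodge_one_of_isSimple_threefold hT hTs hT3 with ⟨h1, -⟩ | ⟨h2, -⟩ | ⟨-, h⟩ | ⟨h6, -, -⟩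
    · omega
    · omega
    · exact h
    · omega
  have h := mtRank_hodge_one_eq_add_one_of_isIsogenous_cmCurve_prod_threefold hX hT hE1 hcm (by omega)
    (hasNoTypeIVFactor_of_isSimple_threefold_of_finrank_eq_three hTs hT3 hTE) hXP
  omega

/-- **CM curve × simple CM threefold: `t ∈ {4, 5}`** (`t + 1 ≤ 2 + 4`; `t = 2` would make `X` a power of a curve and `t = 3` a power of a simple CM
surface or a product of CM curves — impossible with the simple threefold factor `T`). [cite: MoonenZarhin1999LowDim, §3 Prop. (3.8)]
[cite: MumfordAV1970, §19 Thm. 1] -/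
theorem mtRank_hodge_one_mem_of_isIsogenous_cmCurve_prod_isSimple_cmThreefold (hX : IsSmoothProjective n X.X) {E T : AbelianVariety ℂ}
    (hE1 : E.dim = 1) (hcm : IsOfCMType E) (hTs : T.IsSimple) (hT3 : T.dim = 3) (hTcm : IsOfCMType T) (hXP : IsIsogenous X (E.prod T)) :
    haveI := BettiUniverse.finite hX 1
    (BettiUniverse.hodge exists_isReal_hodgeModel_holds hX 1).mtRank = 4 ∨ (BettiUniverse.hodge exists_isReal_hodgeModel_holds hX 1).mtRank = 5 := by
  classical
  have hE : IsSmoothProjective E.dim E.X := AbelianVariety.isSmoothProjective_holds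
  have hT : IsSmoothProjective T.dim T.X := AbelianVariety.isSmoothProjective_holds
  haveI := BettiUniverse.finite hX 1
  haveI := BettiUniverse.finite hE 1
  haveI := BettiUniverse.finite hT 1
  obtain ⟨g, hg⟩ := hXP
  have h0 : 0 < X.dim := by rw [dim_eq_of_isIsogeny hg, dim_prod]; omega
  have h2 := mtRank_hodge_one_eq_two_of_cm_curve hE1 hcm
  have h4 : (BettiUniverse.hodge exists_isReal_hodgeModel_holds hT 1).mtRank = 4 := by
    rcases mtRank_hodge_one_of_isSimple_threefold hT hTs hT3 with ⟨h1, -⟩ | ⟨-, h10⟩ | ⟨-, h10⟩ | ⟨-, -, h⟩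
    · exact absurd hTcm (not_isOfCMType_of_hasNoTypeIVFactor hT (by omega) (hasNoTypeIVFactor_of_finrank_endAlgebra_eq_one h1))
    · -- imaginary quadratic `End⁰`: `t(T) = 10 > dim T + 1` contradicts CM
      have hle := mtRank_hodge_one_le_dim_add_one_of_isOfCMType hT (by omega) hTcm
      omega
    · have hle := mtRank_hodge_one_le_dim_add_one_of_isOfCMType hT (by omega) hTcm
      omega
    · exact h
  have hle := mtRank_hodge_one_add_one_le_add_of_isIsogenous_prod hE hT (by omega) (by omega) hX ⟨g, hg⟩
  have hge := two_le_mtRank_hodge_one hX h0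
  have hTX : AVDominatedBy T X := (avDominatedBy_prod_right E T).trans_isIsogeny_inv hg
  have hne2 : (BettiUniverse.hodge exists_isReal_hodgeModel_holds hX 1).mtRank ≠ 2 := fun h => by
    obtain ⟨E₀, N, hE₀1, -, ⟨f, hf⟩⟩ := (mtRank_hodge_one_eq_two_iff hX h0).1 h
    obtain ⟨f', hf'⟩ := isIsogenous_powSucc_biproduct E₀ N
    obtain ⟨-, ⟨u, hu⟩⟩ := exists_isIsogenous_of_isSimple_of_avDominatedBy_biproduct (fun _ => isSimple_of_dim_le_one hE₀1.le) hTs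
      (by omega) ((hTX.trans_isIsogeny_hom hf).trans_isIsogeny_hom hf')
    have := dim_eq_of_isIsogeny hu
    omega
  have hne3 : (BettiUniverse.hodge exists_isReal_hodgeModel_holds hX 1).mtRank ≠ 3 := fun h => by
    rcases (mtRank_hodge_one_eq_three_iff_surface_or_elliptic hX h0).1 h with ⟨S', hS's, hS'2, -, N, ⟨f, hf⟩⟩ | ⟨E', hE'1, -, -, m, cls, -, ⟨f, hf⟩⟩
    · obtain ⟨f', hf'⟩ := isIsogenous_powSucc_biproduct S' N
      obtain ⟨-, ⟨u, hu⟩⟩ := exists_isIsogenous_of_isSimple_of_avDominatedBy_biproduct (fun _ => hS's) hTs (by omega)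
        ((hTX.trans_isIsogeny_hom hf).trans_isIsogeny_hom hf')
      have := dim_eq_of_isIsogeny hu
      omega
    · obtain ⟨j, ⟨u, hu⟩⟩ := exists_isIsogenous_of_isSimple_of_avDominatedBy_biproduct
        (fun j => isSimple_of_dim_le_one (hE'1 (cls j)).le) hTs (by omega) (hTX.trans_isIsogeny_hom hf)
      have := dim_eq_of_isIsogeny hu
      have := hE'1 (cls j)
      omega
  omega

/-- **CM curve × simple threefold with imaginary quadratic `End⁰` (Ribet type IV (2,1)): `t ≤ 11`** (`t + 1 ≤ 2 + 10`; equality unless the CM field of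
`E` embeds into `End⁰T`, Moonen–Zarhin Lemma (3.6) — not decided here). [cite: MoonenZarhin1999LowDim, §3 Lemma (3.6) and Prop. (3.8)] -/
theorem mtRank_hodge_one_le_eleven_of_isIsogenous_cmCurve_prod_isSimple_threefold_of_finrank_eq_two (hX : IsSmoothProjective n X.X)
    {E T : AbelianVariety ℂ} (hE1 : E.dim = 1) (hcm : IsOfCMType E) (hTs : T.IsSimple) (hT3 : T.dim = 3)
    (hTE : Module.finrank ℚ T.endAlgebra = 2) (hXP : IsIsogenous X (E.prod T)) :
    haveI := BettiUniverse.finite hX 1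
    (BettiUniverse.hodge exists_isReal_hodgeModel_holds hX 1).mtRank ≤ 11 := by
  have hE : IsSmoothProjective E.dim E.X := AbelianVariety.isSmoothProjective_holds
  have hT : IsSmoothProjective T.dim T.X := AbelianVariety.isSmoothProjective_holds
  haveI := BettiUniverse.finite hX 1
  haveI := BettiUniverse.finite hE 1
  haveI := BettiUniverse.finite hT 1
  have h2 := mtRank_hodge_one_eq_two_of_cm_curve hE1 hcm
  have h10 : (BettiUniverse.hodge exists_isReal_hodgeModel_holds hT 1).mtRank = 10 := by
    rcases mtRank_hodge_one_of_isSimple_threefold hT hTs hT3 with ⟨h1, -⟩ | ⟨-, h⟩ | ⟨h3, -⟩ | ⟨h6, -, -⟩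
    · omega
    · exact h
    · omega
    · omega
  have hle := mtRank_hodge_one_add_one_le_add_of_isIsogenous_prod hE hT (by omega) (by omega) hX hXP
  omega

end Summit.HodgeConjecture.CorCM

end
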